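import Literature.NumberTheory.GaloisRepresentations.LocalGlobalCohomology
import HarnessLib

/-!
# The index of a Selmer group in a relaxed one is bounded by the product of the local indices
# (`[H¹_𝓖(K, M) : H¹_𝓕(K, M)] ≤ ∏_{v ∈ S} [𝓖_v : 𝓕_v]` when `𝓖_v ⊆ 𝓕_v` off `S`) — proofs file

Topic `NumberTheory/GaloisRepresentations` (sequel to `LocalGlobalCohomology`: `SelmerStructure`, `selmerGroup`,
`mem_selmerGroup_iff`). THEOREMS ONLY: no definition, no named fact, no instance, no `sorry`. Pure bookkeeping with
Mathlib's `AddSubgroup.relIndex` API (`relIndex_iInf_le`, `relIndex_comap`, `relIndex_le_of_le_right`); no duality.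

For a discrete Galois module `ρ` over a number field `K`, Selmer structures `𝓕`, `𝓖` (no inclusion between them is
assumed) and a finite set `S` of places, and a subgroup `G ≤ H¹(K, M)` whose classes satisfy `𝓖_v` at the places of
`S` and `𝓕_v` at the places outside `S` (e.g. `G = H¹_𝓖(K, M)` when `𝓖_v ≤ 𝓕_v` off `S`):

* `inf_selmerGroup_eq_iInf_comap_inf` — inside `G`, the Selmer condition `𝓕` is the finitely many conditions
  `loc_v c ∈ 𝓕_v`, `v ∈ S`;
* **`finite_quotient_selmerGroup_of_local`**, **`natCard_quotient_selmerGroup_le_prod_of_local`** — if the local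
  quotients `𝓖_v / (𝓕_v ∩ 𝓖_v)`, `v ∈ S`, are finite, then `G / (H¹_𝓕 ∩ G)` is finite and
  `#(G / (H¹_𝓕 ∩ G)) ≤ ∏_{v ∈ S} #(𝓖_v / (𝓕_v ∩ 𝓖_v))` (the map `c ↦ (loc_v c)_v` embeds the global quotient in
  the product of the local ones);
* `finite_quotient_selmerGroup_of_le`, `natCard_quotient_selmerGroup_le_prod_of_le` — the same for
  `G ≤ H¹_𝓖(K, M)` and `𝓖_v ≤ 𝓕_v` off `S`; `finite_quotient_selmerGroup`, `natCard_quotient_selmerGroup_le_prod` —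
  the case `G = H¹_𝓖(K, M)`.

WHY (cell `pub/bsd-print-x9`, shared μ-crux `MuInequalityCoherentPairOfPrintCG` stmt-BirchSwinnertonDyer-23428, STUB B,
registered clause `HeegnerMuPartControlGlue.Stmt.readoutIndex` (B5, p670216); seat `bsd-line-x10b-p1-w2` g11, brick
(B5-GLOB)): Howard's Prop. 2.2.8 (second map) bounds `Sel_∞[𝔮] / im H¹_{F_𝔮}(K, A_𝔮)`; after the bookkeeping of
p671042/p670633 the bound is that of a Selmer group (Howard's propagated conditions `condA`) inside the classes that
are Selmer over `K_∞` — relaxed conditions at the finitely many places of `S` — so the global index is at most the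
product of the local indices at `v ∈ S`, each bounded by a finite module independent of `𝔮` (Greenberg LNM 1716 §4,
«`|ker(r)| = ∏_v |ker(r_v)|`»). This file is the place-wise half of that reduction; the level-wise (direct-limit) half
is `Howard2004/SelmerAIndexLevelwiseProofs`.

References: [MazurRubinMemoirs2004] B. Mazur, K. Rubin, *Kolyvagin systems*, Def. 2.1.1 and Lemma 2.3.5's proof;
[GreenbergLNM1716] R. Greenberg, LNM 1716 (1999), §4 p. 104; [Howard2004HeegnerKolyvagin] B. Howard, Compositio 140
(2004), Prop. 2.2.8.  BSD is not proved by any of this.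
-/

set_option autoImplicit false

noncomputable section

open NumberField

universe u

namespace Literature.NumberTheory.GaloisRepresentations.DiscreteGaloisModule.SelmerStructure

variable {K : Type u} [Field K] [NumberField K] {M : Type u} [AddCommGroup M]
  [TopologicalSpace M] [DiscreteTopology M] {ρ : DiscreteGaloisModule K M}

/-! ## §1 Inside `G`, the condition `𝓕` is finitely many local conditions -/

/-- **`H¹_𝓕 ∩ G = (⨅_{v ∈ S} loc_v⁻¹ 𝓕_v) ∩ G`** for a subgroup `G ≤ H¹(K, M)` whose classes satisfy `𝓕_v` at every
place outside `S`. [cite: MazurRubinMemoirs2004, Def. 2.1.1] -/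
theorem inf_selmerGroup_eq_iInf_comap_inf (𝓕 : SelmerStructure ρ) (S : Finset (Place K))
    (G : AddSubgroup (galoisCohomology ρ 1))
    (hGoff : ∀ c ∈ G, ∀ v ∉ S, galoisCohomology.localization ρ v 1 c ∈ 𝓕 v) :
    𝓕.selmerGroup ⊓ G =
      (⨅ v : ↥S, (𝓕 (v : Place K)).comap (galoisCohomology.localization ρ v 1)) ⊓ G := by
  ext c
  simp only [AddSubgroup.mem_inf, AddSubgroup.mem_iInf, AddSubgroup.mem_comap, mem_selmerGroup_iff]
  constructor
  · rintro ⟨hc, hcG⟩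
    exact ⟨fun v => hc v, hcG⟩
  · rintro ⟨hc, hcG⟩
    refine ⟨fun v => ?_, hcG⟩
    by_cases hv : v ∈ S
    · exact hc ⟨v, hv⟩
    · exact hGoff c hcG v hv

/-- The relative index of `H¹_𝓕` in such a `G` is that of the finitely many conditions `loc_v c ∈ 𝓕_v`, `v ∈ S`.
[cite: MazurRubinMemoirs2004, Def. 2.1.1] -/
theorem relIndex_selmerGroup_eq_relIndex_iInf_comap (𝓕 : SelmerStructure ρ) (S : Finset (Place K))
    (G : AddSubgroup (galoisCohomology ρ 1))
    (hGoff : ∀ c ∈ G, ∀ v ∉ S, galoisCohomology.localization ρ v 1 c ∈ 𝓕 v) :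
    𝓕.selmerGroup.relIndex G =
      (⨅ v : ↥S, (𝓕 (v : Place K)).comap (galoisCohomology.localization ρ v 1)).relIndex G := by
  rw [← AddSubgroup.inf_relIndex_right 𝓕.selmerGroup G, inf_selmerGroup_eq_iInf_comap_inf 𝓕 S G hGoff,
    AddSubgroup.inf_relIndex_right]

/-! ## §2 The global index is at most the product of the local indices -/

/-- For `c ∈ G ↦ loc_v c ∈ 𝓖_v` (`v ∈ S`): `loc_v(G) ≤ 𝓖_v`, so `[loc_v(G) : 𝓕_v ∩ loc_v(G)] ≤ [𝓖_v : 𝓕_v ∩ 𝓖_v]`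
whenever the latter is finite (i.e. nonzero). [cite: MazurRubinMemoirs2004, Def. 2.1.1] -/
theorem relIndex_map_localization_le (𝓕 𝓖 : SelmerStructure ρ) (G : AddSubgroup (galoisCohomology ρ 1))
    (v : Place K) (hGv : ∀ c ∈ G, galoisCohomology.localization ρ v 1 c ∈ 𝓖 v)
    (hfin : (𝓕 v).relIndex (𝓖 v) ≠ 0) :
    (𝓕 v).relIndex (G.map (galoisCohomology.localization ρ v 1)) ≠ 0 ∧
      (𝓕 v).relIndex (G.map (galoisCohomology.localization ρ v 1)) ≤ (𝓕 v).relIndex (𝓖 v) := by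
  have hle : G.map (galoisCohomology.localization ρ v 1) ≤ 𝓖 v := by
    rintro _ ⟨c, hc, rfl⟩
    exact hGv c hc
  exact ⟨fun h => hfin (AddSubgroup.relIndex_eq_zero_of_le_right hle h),
    AddSubgroup.relIndex_le_of_le_right hle hfin⟩

/-- **Finiteness of the global quotient from finiteness of the local ones.** For a subgroup `G ≤ H¹(K, M)` whose
classes satisfy `𝓖_v` at `v ∈ S` and `𝓕_v` at `v ∉ S`: if `𝓖_v / (𝓕_v ∩ 𝓖_v)` is finite for every `v ∈ S`, then
`G / (H¹_𝓕(K, M) ∩ G)` is finite. [cite: MazurRubinMemoirs2004, Def. 2.1.1 and proof of Lemma 2.3.5]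
[cite: GreenbergLNM1716, §4 p. 104] -/
theorem finite_quotient_selmerGroup_of_local (𝓕 𝓖 : SelmerStructure ρ) (S : Finset (Place K))
    (G : AddSubgroup (galoisCohomology ρ 1))
    (hGS : ∀ c ∈ G, ∀ v ∈ S, galoisCohomology.localization ρ v 1 c ∈ 𝓖 v)
    (hGoff : ∀ c ∈ G, ∀ v ∉ S, galoisCohomology.localization ρ v 1 c ∈ 𝓕 v)
    (hfin : ∀ v ∈ S, Finite (↥(𝓖 v) ⧸ (𝓕 v).addSubgroupOf (𝓖 v))) :
    Finite (↥G ⧸ 𝓕.selmerGroup.addSubgroupOf G) := by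
  have hne : 𝓕.selmerGroup.relIndex G ≠ 0 := by
    rw [relIndex_selmerGroup_eq_relIndex_iInf_comap 𝓕 S G hGoff]
    refine AddSubgroup.relIndex_iInf_ne_zero fun v => ?_
    rw [AddSubgroup.relIndex_comap]
    have hv : (𝓕 (v : Place K)).relIndex (𝓖 v) ≠ 0 :=
      AddSubgroup.index_ne_zero_iff_finite.mpr (hfin v v.2)
    exact (relIndex_map_localization_le 𝓕 𝓖 G v (fun c hc => hGS c hc v v.2) hv).1
  exact AddSubgroup.index_ne_zero_iff_finite.mp hne

/-- **`#(G / (H¹_𝓕(K, M) ∩ G)) ≤ ∏_{v ∈ S} #(𝓖_v / (𝓕_v ∩ 𝓖_v))`** for a subgroup `G ≤ H¹(K, M)` whose classes satisfy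
`𝓖_v` at `v ∈ S` and `𝓕_v` at `v ∉ S`, the local quotients at `v ∈ S` being finite: the map `c ↦ (loc_v c)_{v ∈ S}`
embeds the global quotient into the product of the local ones. No inclusion `𝓕 ≤ 𝓖` is assumed.
[cite: MazurRubinMemoirs2004, Def. 2.1.1 and proof of Lemma 2.3.5] [cite: GreenbergLNM1716, §4 p. 104]
[cite: Howard2004HeegnerKolyvagin, Prop. 2.2.8] -/
theorem natCard_quotient_selmerGroup_le_prod_of_local (𝓕 𝓖 : SelmerStructure ρ) (S : Finset (Place K))
    (G : AddSubgroup (galoisCohomology ρ 1))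
    (hGS : ∀ c ∈ G, ∀ v ∈ S, galoisCohomology.localization ρ v 1 c ∈ 𝓖 v)
    (hGoff : ∀ c ∈ G, ∀ v ∉ S, galoisCohomology.localization ρ v 1 c ∈ 𝓕 v)
    (hfin : ∀ v ∈ S, Finite (↥(𝓖 v) ⧸ (𝓕 v).addSubgroupOf (𝓖 v))) :
    Nat.card (↥G ⧸ 𝓕.selmerGroup.addSubgroupOf G) ≤
      ∏ v ∈ S, Nat.card (↥(𝓖 v) ⧸ (𝓕 v).addSubgroupOf (𝓖 v)) := by
  change 𝓕.selmerGroup.relIndex G ≤ ∏ v ∈ S, (𝓕 v).relIndex (𝓖 v)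
  rw [relIndex_selmerGroup_eq_relIndex_iInf_comap 𝓕 S G hGoff, ← Finset.prod_coe_sort S]
  refine (AddSubgroup.relIndex_iInf_le _).trans (Finset.prod_le_prod' fun v _ => ?_)
  rw [AddSubgroup.relIndex_comap]
  have hv : (𝓕 (v : Place K)).relIndex (𝓖 v) ≠ 0 :=
    AddSubgroup.index_ne_zero_iff_finite.mpr (hfin v v.2)
  exact (relIndex_map_localization_le 𝓕 𝓖 G v (fun c hc => hGS c hc v v.2) hv).2

/-! ## §3 The forms with `G ≤ H¹_𝓖(K, M)` and `𝓖_v ≤ 𝓕_v` off `S` -/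

/-- Finiteness of `G / (H¹_𝓕 ∩ G)` for `G ≤ H¹_𝓖(K, M)`, `𝓖_v ≤ 𝓕_v` off `S`, finite local quotients on `S`.
[cite: MazurRubinMemoirs2004, Def. 2.1.1 and proof of Lemma 2.3.5] [cite: GreenbergLNM1716, §4 p. 104] -/
theorem finite_quotient_selmerGroup_of_le (𝓕 𝓖 : SelmerStructure ρ) (S : Finset (Place K))
    (hS : ∀ v ∉ S, 𝓖 v ≤ 𝓕 v) (G : AddSubgroup (galoisCohomology ρ 1)) (hG : G ≤ 𝓖.selmerGroup)
    (hfin : ∀ v ∈ S, Finite (↥(𝓖 v) ⧸ (𝓕 v).addSubgroupOf (𝓖 v))) :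
    Finite (↥G ⧸ 𝓕.selmerGroup.addSubgroupOf G) :=
  finite_quotient_selmerGroup_of_local 𝓕 𝓖 S G
    (fun c hc v _ => (mem_selmerGroup_iff 𝓖 c).mp (hG hc) v)
    (fun c hc v hv => hS v hv ((mem_selmerGroup_iff 𝓖 c).mp (hG hc) v)) hfin

/-- **`#(G / (H¹_𝓕 ∩ G)) ≤ ∏_{v ∈ S} #(𝓖_v / (𝓕_v ∩ 𝓖_v))`** for `G ≤ H¹_𝓖(K, M)`, `𝓖_v ≤ 𝓕_v` off `S`, finite local
quotients on `S`. [cite: MazurRubinMemoirs2004, Def. 2.1.1 and proof of Lemma 2.3.5] [cite: GreenbergLNM1716, §4 p. 104]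
[cite: Howard2004HeegnerKolyvagin, Prop. 2.2.8] -/
theorem natCard_quotient_selmerGroup_le_prod_of_le (𝓕 𝓖 : SelmerStructure ρ) (S : Finset (Place K))
    (hS : ∀ v ∉ S, 𝓖 v ≤ 𝓕 v) (G : AddSubgroup (galoisCohomology ρ 1)) (hG : G ≤ 𝓖.selmerGroup)
    (hfin : ∀ v ∈ S, Finite (↥(𝓖 v) ⧸ (𝓕 v).addSubgroupOf (𝓖 v))) :
    Nat.card (↥G ⧸ 𝓕.selmerGroup.addSubgroupOf G) ≤
      ∏ v ∈ S, Nat.card (↥(𝓖 v) ⧸ (𝓕 v).addSubgroupOf (𝓖 v)) :=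
  natCard_quotient_selmerGroup_le_prod_of_local 𝓕 𝓖 S G
    (fun c hc v _ => (mem_selmerGroup_iff 𝓖 c).mp (hG hc) v)
    (fun c hc v hv => hS v hv ((mem_selmerGroup_iff 𝓖 c).mp (hG hc) v)) hfin

/-- Finiteness of `H¹_𝓖(K, M) / (H¹_𝓕 ∩ H¹_𝓖)` when `𝓖_v ≤ 𝓕_v` off `S` and the local quotients on `S` are finite.
[cite: MazurRubinMemoirs2004, Def. 2.1.1 and proof of Lemma 2.3.5] [cite: GreenbergLNM1716, §4 p. 104] -/
theorem finite_quotient_selmerGroup (𝓕 𝓖 : SelmerStructure ρ) (S : Finset (Place K))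
    (hS : ∀ v ∉ S, 𝓖 v ≤ 𝓕 v) (hfin : ∀ v ∈ S, Finite (↥(𝓖 v) ⧸ (𝓕 v).addSubgroupOf (𝓖 v))) :
    Finite (↥𝓖.selmerGroup ⧸ 𝓕.selmerGroup.addSubgroupOf 𝓖.selmerGroup) :=
  finite_quotient_selmerGroup_of_le 𝓕 𝓖 S hS 𝓖.selmerGroup le_rfl hfin

/-- **`#(H¹_𝓖 / (H¹_𝓕 ∩ H¹_𝓖)) ≤ ∏_{v ∈ S} #(𝓖_v / (𝓕_v ∩ 𝓖_v))`** when `𝓖_v ≤ 𝓕_v` off `S` and the local quotients on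
`S` are finite (for `𝓕 ≤ 𝓖` this is the familiar `[H¹_𝓖 : H¹_𝓕] ≤ ∏_{v ∈ S} [𝓖_v : 𝓕_v]`).
[cite: MazurRubinMemoirs2004, Def. 2.1.1 and proof of Lemma 2.3.5] [cite: GreenbergLNM1716, §4 p. 104]
[cite: Howard2004HeegnerKolyvagin, Prop. 2.2.8] -/
theorem natCard_quotient_selmerGroup_le_prod (𝓕 𝓖 : SelmerStructure ρ) (S : Finset (Place K))
    (hS : ∀ v ∉ S, 𝓖 v ≤ 𝓕 v) (hfin : ∀ v ∈ S, Finite (↥(𝓖 v) ⧸ (𝓕 v).addSubgroupOf (𝓖 v))) :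
    Nat.card (↥𝓖.selmerGroup ⧸ 𝓕.selmerGroup.addSubgroupOf 𝓖.selmerGroup) ≤
      ∏ v ∈ S, Nat.card (↥(𝓖 v) ⧸ (𝓕 v).addSubgroupOf (𝓖 v)) :=
  natCard_quotient_selmerGroup_le_prod_of_le 𝓕 𝓖 S hS 𝓖.selmerGroup le_rfl hfin

end Literature.NumberTheory.GaloisRepresentations.DiscreteGaloisModule.SelmerStructure

end
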